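import Summits.Ventures.HodgeRepro2.T5SU11GreenIdentityInhomogeneous
import Summits.Ventures.HodgeRepro2.T5SU11ResolventBoundary
import Summits.Ventures.HodgeRepro2.T5SU11SphericalGreen

/-!
# The resolvent against a spherical function: the boundary terms vanish and `(G_λ f) φ_{λ′} sinh 2t` is integrable

For `1 < λ′ < λ` and a continuous source `f` supported in `[a, b] ⊂ (0, ∞)`, the Green's solution `u = G_λ f` of
rows 451–452 and the spherical function `v = φ_{λ′}(a_·)` satisfy Green's identity on `[ε, R]` (row 467):
`∫_ε^R f v sinh 2t = W(R) − W(ε) + (μ′ − μ) ∫_ε^R u v sinh 2t`, `W = sinh 2t (v u′ − u v′)`, `μ = λ(λ−2)`,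
`μ′ = λ′(λ′−2)`. This row supplies the three inputs of the passage `ε → 0⁺`, `R → ∞` (carried out in the next row,
`T5SU11ResolventDiagonal`):

* on `(0, a]` the solution is `u = −c₁ φ_λ` (`c₁ = ∫_a^b χ_λ f sinh 2s`; `sphGreen_of_le`), so that by row 338's
  Lagrange identity `W(ε) = −c₁ (μ − μ′) ∫_0^ε sinh 2t φ_λ φ_{λ′}` (`green_bracket_left`) and **`W(ε) → 0`**
  (`tendsto_green_bracket_left`);
* on `[b, ∞)` it is `u = −c₂ χ_λ` (`c₂ = ∫_a^b φ_λ f sinh 2s`; `sphGreen_of_ge`), so that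
  `W(R) = −c₂ sinh 2R (φ_{λ′} χ_λ′ − χ_λ φ_{λ′}′)` (`green_bracket_right`) and **`W(R) → 0`** by row 468
  (`tendsto_green_bracket_right`);
* **`u v sinh 2t` is integrable on `(0, ∞)`** (`integrableOn_green_mul_sph`): bounded near `0`, continuous in the
  middle, and `O(e^{(λ′−λ)t})` at infinity by the exact rate of `χ_λ` (row 450) and the growth bound of `φ_{λ′}`.

Nothing is claimed about (N).

Blind lane: Mathlib + the HodgeRepro2 prefix only; no sorry; axioms ⊆ {propext, Classical.choice,
Quot.sound}.
-/

namespace Summit.Ventures.HodgeRepro2.T5SU11ResolventTransform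

open Filter Topology MeasureTheory intervalIntegral
open Set (Ioi Ioc Icc uIcc)
open T5SU11Cartan T5SU11SphericalFunction T5SU11SphericalBounds T5SU11SphericalContinuous
  T5SU11SphericalAsymptotic T5SU11SphericalCfun T5SU11SphericalUnique T5SU11ReductionOfOrder
  T5SU11ReductionOfOrderInfinity T5SU11SphericalSolutionSpaceAll T5SU11SphericalDecay
  T5SU11SphericalDecayAsymptotic T5SU11RadialGreen T5SU11SphericalGreen T5SU11GreenIdentityInhomogeneous
  T5SU11ResolventBoundary

section measure

variable [MeasurableSpace Circle] [BorelSpace Circle]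

variable {lam lam' a b : ℝ} {f : ℝ → ℝ} (h1 : 1 < lam') (h2 : lam' < lam) (hf : ContinuousOn f (Ioi 0))
  (ha : 0 < a) (hab : a ≤ b) (hfa : ∀ s, s ≤ a → f s = 0) (hfb : ∀ s, b ≤ s → f s = 0)

/-! ### The two pieces of the Green's solution and its derivative -/

include h1 h2 hf ha hab hfa in
/-- `B(t) = 0` and `A(t) = ∫_a^b χ_λ f sinh 2s` for `0 < t ≤ a`. -/
theorem greenBA_of_le {t : ℝ} (ht : 0 < t) (hta : t ≤ a) :
    greenB (fun t => sph lam (hyp t)) f a t = 0 ∧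
    greenA (sphDecay lam) f b t = ∫ s in a..b, sphDecay lam s * f s * Real.sinh (2 * s) := by
  have hlam : 1 < lam := lt_trans h1 h2
  constructor
  · unfold greenB
    rw [← intervalIntegral.integral_zero]
    refine integral_congr (fun s hs => ?_)
    rcases Set.mem_uIcc.mp hs with ⟨_, h2⟩ | ⟨_, h2⟩
    · rw [hfa s (le_trans h2 hta)]; ring
    · rw [hfa s h2]; ring
  · unfold greenA
    have hc := continuousOn_greenB_integrand (fun _ ht => hasDerivAt_sphDecay hlam ht) hf
    have hb : 0 < b := lt_of_lt_of_le ha hab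
    rw [← integral_add_adjacent_intervals ((hc.mono (uIcc_subset_Ioi ht ha)).intervalIntegrable)
      ((hc.mono (uIcc_subset_Ioi ha hb)).intervalIntegrable)]
    have h0 : ∫ s in t..a, sphDecay lam s * f s * Real.sinh (2 * s) = 0 := by
      rw [← intervalIntegral.integral_zero]
      refine integral_congr (fun s hs => ?_)
      rcases Set.mem_uIcc.mp hs with ⟨_, h2⟩ | ⟨_, h2⟩
      · rw [hfa s h2]; ring
      · rw [hfa s (le_trans h2 hta)]; ring
    rw [h0, zero_add]

include hf ha hab hfb in
/-- `A(t) = 0` and `B(t) = ∫_a^b φ_λ f sinh 2s` for `t ≥ b`. -/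
theorem greenBA_of_ge {t : ℝ} (htb : b ≤ t) :
    greenA (sphDecay lam) f b t = 0 ∧
    greenB (fun t => sph lam (hyp t)) f a t = ∫ s in a..b, sph lam (hyp s) * f s * Real.sinh (2 * s) := by
  have hb : 0 < b := lt_of_lt_of_le ha hab
  have ht : 0 < t := lt_of_lt_of_le hb htb
  constructor
  · unfold greenA
    rw [← intervalIntegral.integral_zero]
    refine integral_congr (fun s hs => ?_)
    rcases Set.mem_uIcc.mp hs with ⟨h1, _⟩ | ⟨h1, _⟩
    · rw [hfb s (le_trans htb h1)]; ring
    · rw [hfb s h1]; ring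
  · unfold greenB
    have hc := continuousOn_greenB_integrand (hφ_sph lam) hf
    rw [← integral_add_adjacent_intervals ((hc.mono (uIcc_subset_Ioi ha hb)).intervalIntegrable)
      ((hc.mono (uIcc_subset_Ioi hb ht)).intervalIntegrable)]
    have h0 : ∫ s in b..t, sph lam (hyp s) * f s * Real.sinh (2 * s) = 0 := by
      rw [← intervalIntegral.integral_zero]
      refine integral_congr (fun s hs => ?_)
      rcases Set.mem_uIcc.mp hs with ⟨h1, _⟩ | ⟨h1, _⟩
      · rw [hfb s h1]; ring
      · rw [hfb s (le_trans htb h1)]; ring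
    rw [h0, add_zero]

/-! ### The Green's solution and its derivative outside the support -/

include h1 h2 hf ha hab hfa in
/-- On `(0, a]`: `u = −c₁ φ_λ` and `u′ = −c₁ φ_λ′`, `c₁ = ∫_a^b χ_λ f sinh 2s`. -/
theorem sphGreen_of_le {t : ℝ} (ht : 0 < t) (hta : t ≤ a) :
    sphGreen lam f a b t = -(∫ s in a..b, sphDecay lam s * f s * Real.sinh (2 * s)) * sph lam (hyp t) ∧
    sphGreen' lam f a b t = -(∫ s in a..b, sphDecay lam s * f s * Real.sinh (2 * s))
      * deriv (fun t => sph lam (hyp t)) t := by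
  obtain ⟨hB, hA⟩ := greenBA_of_le h1 h2 hf ha hab hfa ht hta
  constructor
  · unfold sphGreen greenSol
    rw [hB, hA]
    ring
  · unfold sphGreen' greenSol'
    rw [hB, hA]
    ring

include hf ha hab hfb in
/-- On `[b, ∞)`: `u = −c₂ χ_λ` and `u′ = −c₂ χ_λ′`, `c₂ = ∫_a^b φ_λ f sinh 2s`. -/
theorem sphGreen_of_ge {t : ℝ} (htb : b ≤ t) :
    sphGreen lam f a b t = -(∫ s in a..b, sph lam (hyp s) * f s * Real.sinh (2 * s)) * sphDecay lam t ∧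
    sphGreen' lam f a b t = -(∫ s in a..b, sph lam (hyp s) * f s * Real.sinh (2 * s)) * sphDecay' lam t := by
  obtain ⟨hA, hB⟩ := greenBA_of_ge hf ha hab hfb htb
  constructor
  · unfold sphGreen greenSol
    rw [hB, hA]
    ring
  · unfold sphGreen' greenSol'
    rw [hB, hA]
    ring

/-! ### The boundary terms -/

include h1 h2 hf ha hab hfa in
/-- **The bracket at `ε ≤ a`**: `W(ε) = −c₁ (μ − μ′) ∫_0^ε sinh 2t φ_λ φ_{λ′}`. -/
theorem green_bracket_left {ε : ℝ} (hε : 0 < ε) (hεa : ε ≤ a) :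
    Real.sinh (2 * ε) * (sph lam' (hyp ε) * sphGreen' lam f a b ε
      - sphGreen lam f a b ε * deriv (fun t => sph lam' (hyp t)) ε)
    = -(∫ s in a..b, sphDecay lam s * f s * Real.sinh (2 * s))
      * ((lam * (lam - 2) - lam' * (lam' - 2)) * ∫ t in (0 : ℝ)..ε,
          Real.sinh (2 * t) * sph lam (hyp t) * sph lam' (hyp t)) := by
  obtain ⟨hu, hu'⟩ := sphGreen_of_le h1 h2 hf ha hab hfa hε hεa
  rw [hu, hu', lagrange_identity lam lam' ε]
  ring

include h1 h2 hf ha hab hfa in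
/-- **`W(ε) → 0` as `ε → 0⁺`.** -/
theorem tendsto_green_bracket_left :
    Tendsto (fun ε => Real.sinh (2 * ε) * (sph lam' (hyp ε) * sphGreen' lam f a b ε
      - sphGreen lam f a b ε * deriv (fun t => sph lam' (hyp t)) ε)) (𝓝[>] 0) (𝓝 0) := by
  -- `∫_0^ε … → 0` by continuity of the primitive at `0`
  have hcont := continuous_integrand lam lam'
  have hprim : Tendsto (fun ε => ∫ t in (0 : ℝ)..ε, Real.sinh (2 * t) * sph lam (hyp t) * sph lam' (hyp t))
      (𝓝 0) (𝓝 (∫ t in (0 : ℝ)..(0 : ℝ), Real.sinh (2 * t) * sph lam (hyp t) * sph lam' (hyp t))) := by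
    have hd := integral_hasDerivAt_right (hcont.intervalIntegrable 0 0)
      (hcont.stronglyMeasurableAtFilter _ _) hcont.continuousAt
    exact hd.continuousAt.tendsto
  rw [integral_same] at hprim
  have h0 : Tendsto (fun ε => ∫ t in (0 : ℝ)..ε, Real.sinh (2 * t) * sph lam (hyp t) * sph lam' (hyp t))
      (𝓝[>] 0) (𝓝 0) := hprim.mono_left (nhdsWithin_le_nhds (s := Ioi 0))
  have h := (h0.const_mul (lam * (lam - 2) - lam' * (lam' - 2))).const_mul
    (-(∫ s in a..b, sphDecay lam s * f s * Real.sinh (2 * s)))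
  simp only [mul_zero] at h
  refine h.congr' ?_
  filter_upwards [Ioo_mem_nhdsGT ha] with ε hε
  exact (green_bracket_left h1 h2 hf ha hab hfa hε.1 hε.2.le).symm

include hf ha hab hfb in
/-- **The bracket at `R ≥ b`**: `W(R) = −c₂ · sinh 2R (φ_{λ′} χ_λ′ − χ_λ φ_{λ′}′)`. -/
theorem green_bracket_right {R : ℝ} (hbR : b ≤ R) :
    Real.sinh (2 * R) * (sph lam' (hyp R) * sphGreen' lam f a b R
      - sphGreen lam f a b R * deriv (fun t => sph lam' (hyp t)) R)
    = -(∫ s in a..b, sph lam (hyp s) * f s * Real.sinh (2 * s))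
      * (Real.sinh (2 * R) * (sph lam' (hyp R) * sphDecay' lam R
          - sphDecay lam R * deriv (fun t => sph lam' (hyp t)) R)) := by
  obtain ⟨hu, hu'⟩ := sphGreen_of_ge hf ha hab hfb hbR
  rw [hu, hu']
  ring

include h1 h2 hf ha hab hfb in
/-- **`W(R) → 0` as `R → ∞`.** -/
theorem tendsto_green_bracket_right :
    Tendsto (fun R => Real.sinh (2 * R) * (sph lam' (hyp R) * sphGreen' lam f a b R
      - sphGreen lam f a b R * deriv (fun t => sph lam' (hyp t)) R)) atTop (𝓝 0) := by
  have h := (tendsto_green_bracket_decay h1 h2).const_mul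
    (-(∫ s in a..b, sph lam (hyp s) * f s * Real.sinh (2 * s)))
  rw [mul_zero] at h
  refine h.congr' ?_
  filter_upwards [eventually_ge_atTop b] with R hR
  exact (green_bracket_right hf ha hab hfb hR).symm

/-! ### Integrability of `u v sinh 2t` on `(0, ∞)` -/

include h1 h2 hf ha hab in
/-- `u v sinh 2t` is continuous on `(0, ∞)`. -/
theorem continuousOn_green_mul_sph :
    ContinuousOn (fun t => sphGreen lam f a b t * sph lam' (hyp t) * Real.sinh (2 * t)) (Ioi 0) := by
  have hlam := lt_trans h1 h2
  have hu : ContinuousOn (sphGreen lam f a b) (Ioi 0) :=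
    fun t ht => (hasDerivAt_sphGreen hlam hf ha hab ht).continuousAt.continuousWithinAt
  exact (hu.mul (continuous_sph_hyp lam').continuousOn).mul
    (Real.continuous_sinh.comp (continuous_const.mul continuous_id)).continuousOn

include h1 h2 hf ha hab hfa hfb in
/-- **`u v sinh 2t` is integrable on `(0, ∞)`.** -/
theorem integrableOn_green_mul_sph :
    IntegrableOn (fun t => sphGreen lam f a b t * sph lam' (hyp t) * Real.sinh (2 * t)) (Ioi 0) := by
  have hlam := lt_trans h1 h2
  have hb : 0 < b := lt_of_lt_of_le ha hab
  set c₁ := ∫ s in a..b, sphDecay lam s * f s * Real.sinh (2 * s) with hc₁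
  set c₂ := ∫ s in a..b, sph lam (hyp s) * f s * Real.sinh (2 * s) with hc₂
  have hcont := continuousOn_green_mul_sph h1 h2 hf ha hab
  -- `(0, a]`: a continuous function of `ℝ`
  have hI1 : IntegrableOn (fun t => sphGreen lam f a b t * sph lam' (hyp t) * Real.sinh (2 * t)) (Ioc 0 a) := by
    have hg : Continuous fun t => -c₁ * sph lam (hyp t) * sph lam' (hyp t) * Real.sinh (2 * t) :=
      (((continuous_const.mul (continuous_sph_hyp lam)).mul (continuous_sph_hyp lam')).mul
        (Real.continuous_sinh.comp (continuous_const.mul continuous_id)))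
    refine (hg.integrableOn_Icc.mono_set Set.Ioc_subset_Icc_self).congr_fun (fun t ht => ?_) measurableSet_Ioc
    rw [(sphGreen_of_le h1 h2 hf ha hab hfa ht.1 ht.2).1]
  -- `(a, b]`: continuity
  have hI2 : IntegrableOn (fun t => sphGreen lam f a b t * sph lam' (hyp t) * Real.sinh (2 * t)) (Ioc a b) :=
    ((hcont.mono (fun t ht => lt_of_lt_of_le ha ht.1)).integrableOn_Icc).mono_set Set.Ioc_subset_Icc_self
  -- `(b, ∞)`: the exponential majorant of `−c₂ χ_λ φ_{λ′} sinh 2t`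
  have hI3 : IntegrableOn (fun t => sphGreen lam f a b t * sph lam' (hyp t) * Real.sinh (2 * t)) (Ioi b) := by
    have hL : 0 < 1 / ((lam - 1) * cfun (2 - lam)) := sphDecay_limit_pos hlam
    have hc' : 0 < cfun (2 - lam') := cfun_pos (by linarith)
    -- eventual bounds
    have hχ : ∀ᶠ t in atTop, sphDecay lam t ≤ 2 * (1 / ((lam - 1) * cfun (2 - lam))) * Real.exp (-lam * t) := by
      have h := (tendsto_exp_mul_sphDecay hlam).eventually (eventually_le_nhds (by linarith : 1 / ((lam - 1) * cfun (2 - lam)) < 2 * (1 / ((lam - 1) * cfun (2 - lam)))))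
      filter_upwards [h] with t ht
      have hE : 0 < Real.exp (-lam * t) := Real.exp_pos _
      calc sphDecay lam t = Real.exp (-lam * t) * (Real.exp (lam * t) * sphDecay lam t) := by
            rw [← mul_assoc, ← Real.exp_add, show -lam * t + lam * t = 0 by ring, Real.exp_zero, one_mul]
        _ ≤ Real.exp (-lam * t) * (2 * (1 / ((lam - 1) * cfun (2 - lam)))) := mul_le_mul_of_nonneg_left ht hE.le
        _ = 2 * (1 / ((lam - 1) * cfun (2 - lam))) * Real.exp (-lam * t) := by ring
    obtain ⟨T₀, hT₀⟩ := eventually_atTop.mp (hχ.and (eventually_sph_hyp_le h1))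
    set T := max T₀ b with hT
    have hbT : b ≤ T := le_max_right _ _
    have hJ1 : IntegrableOn (fun t => sphGreen lam f a b t * sph lam' (hyp t) * Real.sinh (2 * t)) (Ioc b T) :=
      ((hcont.mono (fun t ht => lt_of_lt_of_le hb ht.1)).integrableOn_Icc).mono_set Set.Ioc_subset_Icc_self
    have hJ2 : IntegrableOn (fun t => sphGreen lam f a b t * sph lam' (hyp t) * Real.sinh (2 * t)) (Ioi T) := by
      set C := |c₂| * (2 * (1 / ((lam - 1) * cfun (2 - lam)))) * (2 * cfun (2 - lam')) / 2 with hC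
      have hmaj : IntegrableOn (fun t => C * Real.exp (-(lam - lam') * t)) (Ioi T) :=
        (exp_neg_integrableOn_Ioi T (by linarith)).const_mul _
      refine hmaj.mono' ?_ ?_
      · exact (hcont.mono (Set.Ioi_subset_Ioi (le_trans hb.le hbT))).aestronglyMeasurable measurableSet_Ioi
      · refine ae_restrict_of_forall_mem measurableSet_Ioi (fun t ht => ?_)
        have ht' : T < t := ht
        have htb : b ≤ t := le_trans hbT ht'.le
        have ht0 : 0 < t := lt_of_lt_of_le hb htb
        obtain ⟨hb1, hb2⟩ := hT₀ t (le_trans (le_max_left _ _) ht'.le)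
        rw [(sphGreen_of_ge hf ha hab hfb htb).1, Real.norm_eq_abs]
        have hs : Real.sinh (2 * t) ≤ Real.exp (2 * t) / 2 := sinh_le_exp_div_two _
        have hs0 : 0 ≤ Real.sinh (2 * t) := Real.sinh_nonneg_iff.mpr (by linarith)
        have hχ0 : 0 ≤ sphDecay lam t := (sphDecay_pos hlam ht0).le
        have hφ0 : 0 ≤ sph lam' (hyp t) := (sph_hyp_pos lam' t).le
        rw [abs_mul, abs_mul, abs_mul, abs_neg, abs_of_nonneg hχ0, abs_of_nonneg hφ0, abs_of_nonneg hs0]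
        calc |c₂| * sphDecay lam t * sph lam' (hyp t) * Real.sinh (2 * t)
            ≤ |c₂| * (2 * (1 / ((lam - 1) * cfun (2 - lam))) * Real.exp (-lam * t))
              * (2 * cfun (2 - lam') * Real.exp ((lam' - 2) * t)) * (Real.exp (2 * t) / 2) :=
              mul_le_mul (mul_le_mul (mul_le_mul_of_nonneg_left hb1 (abs_nonneg _)) hb2 hφ0 (by positivity))
                hs hs0 (by positivity)
          _ = C * Real.exp (-(lam - lam') * t) := by
              rw [hC, show Real.exp (-(lam - lam') * t)
                  = Real.exp (-lam * t) * Real.exp ((lam' - 2) * t) * Real.exp (2 * t) by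
                  rw [← Real.exp_add, ← Real.exp_add]; congr 1; ring]
              ring
    have := hJ1.union hJ2
    rwa [Set.Ioc_union_Ioi_eq_Ioi hbT] at this
  have h12 := hI1.union hI2
  rw [Set.Ioc_union_Ioc_eq_Ioc ha.le hab] at h12
  have := h12.union hI3
  rwa [Set.Ioc_union_Ioi_eq_Ioi hb.le] at this

end measure

end Summit.Ventures.HodgeRepro2.T5SU11ResolventTransform
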